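import Summits.Schanuel.Schanuel.Theorems.RootDecomp1ERadixCell02

/-!
# RootDecomp1ERadixCell — lens 2, generation 42 «THE FINITE-ORDER RADIX-2 CELL: count CONJUGATES, not degree» (lanes E-R19 (i) T below hyper + (iii) the transcendental weight log 2): S ITSELF on the pure-radix class {z_l = (v_l·log 2)·T^{e_l}, T real of FIXED finite exponential order} HYPOTHESIS-FREE and on the mixed radix class {z_l = (u_l + v_l log 2)·T^{e_l}} mod the ONE tree fact hX = ExplicitRatExpApprox — the Kummer-direction degree is paid by COUNTING the 𝔐 conjugates of 2^{1/𝔐} through the resultant norm Res_Y(Y^𝔐 − 2, F), never by a pair measure — continuation (RootDecomp1ERadixCell03): §3 radix curve point, collapse, root and residue avoidance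

(lens-2 g42 HOME kernel RadixCell.lean d9530aae…, 1851 l, imports tree RootDecomp1EUntwistedWall04 + RootDecomp1KFiniteOrderCell02 only; CLAIM L2067, ACK + CHECKLIST E-g42 L2069, NODE L2089 / REQUEST L2090, critic VERDICT L2095 (crit g8: CLEARED — ONE CELL, tiers 1+2 = one cell; lens-2 tally CELL ×4 (g37, g39, g41, g42); E-R20 closes the radix line; PORT GO `--supports stmt-Schanuel-31410`); port by census-1 gen 18 as `RootDecomp1ERadixCell01`–`08` along K's sections: 01 = §1 the radix field ℚ(2^{1/𝔐}) (`croot`, `zroot`, `broot`, `irreducible_X_pow_sub_two`, degree 𝔐); 02 = §2 the two-level polynomial, conjugate factors `Gfac`, the RESULTANT NORM `resNorm` (`map_resNorm` = ∏ conjugates, `resNorm_ne_zero`, degree / value / Mahler-measure bounds); 03 = §3 the radix curve point `radixPt`, germs, fibres, root and residue avoidance at transcendental parameters; 04 = §4 integral exponents at the collapse (`Mden`, `Aexp`, `Bexp`, the value of G₀, from avoidance to the hypotheses of `resNorm_ne_zero`); 05 = §5 THE PURE-RADIX ENGINE `algebraicIndependent_radixPt_pure` (hypothesis-free, `endgame_pure`)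 + §5b mixed-engine helpers; 06 = §5b THE MIXED ENGINE `algebraicIndependent_radixPt (hX)` (one 320-line theorem, scoped `maxHeartbeats 800000` carried as in K); 07 = §6 classes `InPureRadixClass` / `InRadixClass`, `schanuel_inPureRadixClass` (hyp-free) / `schanuel_inRadixClass (hX)`, cells `cell_31410(_pure)` / `cell_25020(_pure)`, members `zLog2Curve` / `zMix` at tower numbers; 08 = §6 items AT the members + separation (`zMix_not_inPointClass`, `zLog2Curve_not_inPointClass`, `zMix_separation`).
PORT EDITS: 37 one-line docstrings added; five generic helpers made `private` against dedup twins (`mahlerMeasure_finset_prod`, `eval_map_intCast`, `aeval_ne_zero_of_transcendental`, `addNat_eq_natAdd`, `transcendental_log_two` ≡ tree AclSubsetLogFreeCore/Negative) with per-part private copies; statements and proofs verbatim. `--supports stmt-Schanuel-31410`; no census credit carried; rung 0 — nothing here proves Schanuel.)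
-/

noncomputable section

open Complex Polynomial IntermediateField Filter
open scoped BigOperators Topology

namespace Summit.Schanuel.Schanuel.Theorems.RootDecomp1ERadixCell

open Summit.Schanuel.Schanuel.Theorems.RootDecomp1EUntwistedWall (gι gaussPt expo coef tail fib IsZ wden wden_pos
  isZ_expo Wb Wb_nonneg abs_expo_le abs_coef_le expo_eq_of_tail_eq sum_coef_fibre_cast fib_ne_zero diffPoly
  diffPoly_ne_zero eval_diffPoly gι_expo_sub gι_injective tail_eq_of_expo_eq eq_of_tail_eq_of_zero_eq coef_cast
  IsZ.add IsZ.mul IsZ.natCast IsZ.sum isZ_wden_fst isZ_wden_snd InGaussCurveClass)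
open Summit.Schanuel.Schanuel.Theorems.RootDecomp1EPointTransfer (InPointClass)
open Summit.Schanuel.Schanuel.Theorems.RootDecomp1ETwoScale (InTwoScaleClass)
open Summit.Schanuel.Schanuel.Theorems.RootDecomp1EWallDichotomy (InTwistedFrameClass)
open Summit.Schanuel.Schanuel.Theorems.RootDecomp1KHyper
open Summit.Schanuel.Schanuel.Theorems.RootDecomp1KHyper.HyperCell
open Summit.Schanuel.Schanuel.Theorems.RootDecomp1KGeneric (LiouvilleOrder)
open Summit.Schanuel.Schanuel.Theorems.RootDecomp1KFiniteOrderCell (towerNumber liouvilleOrder_towerNumber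
  not_hyperLiouville_towerNumber towerNumber_pos not_liouvilleOrder_towerNumber)
open Summit.Schanuel.Schanuel.Theorems.RootDecomp1BDefectFloorCells (natCast_le_trdeg_of_algebraicIndependent)

/-! ## §3  The radix curve point, the collapse at a rational parameter, root and residue avoidance -/

section Concrete

variable {n : ℕ}

/-- The RADIX WEIGHT `ρ(γ) = γ.1 + γ.2 · log 2 ∈ ℝ` of a pair of rationals (so `e^{ρ(γ)x} = e^{γ.1 x} · 2^{γ.2 x}`). -/
def ρr (γ : ℚ × ℚ) : ℝ := (γ.1 : ℝ) + (γ.2 : ℝ) * Real.log 2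

/-- The radix weight read in `ℂ`. -/
def ρι (γ : ℚ × ℚ) : ℂ := ((ρr γ : ℝ) : ℂ)

/-- **The radix-curve point** `(x, e^{ρ(w₁)x^{e₁}}, …, e^{ρ(w_n)x^{e_n}})`, i.e.
`(x, e^{u_l x^{e_l}} · 2^{v_l x^{e_l}})_l` for `w_l = (u_l, v_l)`. -/
def radixPt (w : Fin n → ℚ × ℚ) (e : Fin n → ℕ) (x : ℂ) : Fin (n + 1) → ℂ :=
  Fin.cons x fun l => cexp (ρι (w l) * x ^ (e l))

/-- The `0`-th coordinate of the radix point is the parameter `x`. -/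
@[simp] theorem radixPt_zero (w : Fin n → ℚ × ℚ) (e : Fin n → ℕ) (x : ℂ) : radixPt w e x 0 = x := by
  simp [radixPt]

/-- The `l+1`-st coordinate of the radix point is `exp(ρι(w l) · x ^ e l)`. -/
@[simp] theorem radixPt_succ (w : Fin n → ℚ × ℚ) (e : Fin n → ℕ) (x : ℂ) (l : Fin n) :
    radixPt w e x l.succ = cexp (ρι (w l) * x ^ (e l)) := by
  simp [radixPt]

/-- `F(x) = P(x, e^{ρ(w_l) x^{e_l}})` along the reals, as an exponential sum over the support. -/
def FR (P : MvPolynomial (Fin (n + 1)) ℤ) (w : Fin n → ℚ × ℚ) (e : Fin n → ℕ) (x : ℝ) : ℂ :=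
  ∑ s ∈ P.support, ((MvPolynomial.coeff s P : ℤ) : ℂ) * (x : ℂ) ^ (s 0) *
    cexp (∑ l : Fin n, (s l.succ : ℂ) * (ρι (w l) * (x : ℂ) ^ (e l)))

/-- The collapsed exponent, read through the radix weight: `ρ(expo_s) = Σ_l s_{l+1} ρ(w_l) r^{e_l}`. -/
theorem ρι_expo (w : Fin n → ℚ × ℚ) (e : Fin n → ℕ) (r : ℚ) (s : Fin (n + 1) →₀ ℕ) :
    ρι (expo w e r s) = ∑ l : Fin n, (s l.succ : ℂ) * (ρι (w l) * (r : ℂ) ^ (e l)) := by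
  have h : ∀ l : Fin n, (s l.succ : ℂ) * (ρι (w l) * (r : ℂ) ^ (e l)) =
      (s l.succ : ℂ) * ((w l).1 : ℂ) * (r : ℂ) ^ (e l) +
        ((s l.succ : ℂ) * ((w l).2 : ℂ) * (r : ℂ) ^ (e l)) * ((Real.log 2 : ℝ) : ℂ) := by
    intro l; simp only [ρι, ρr]; push_cast; ring
  rw [Finset.sum_congr rfl fun l _ => h l, Finset.sum_add_distrib, ← Finset.sum_mul]
  simp only [ρι, ρr, expo]
  push_cast
  rfl

/-- `FR P w e x` is the evaluation of `P` at the radix-curve point with parameter `x`. -/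
theorem FR_eq_aeval (P : MvPolynomial (Fin (n + 1)) ℤ) (w : Fin n → ℚ × ℚ) (e : Fin n → ℕ) (x : ℝ) :
    FR P w e x = MvPolynomial.aeval (radixPt w e (x : ℂ)) P := by
  rw [MvPolynomial.aeval_def, MvPolynomial.eval₂_eq', FR]
  refine Finset.sum_congr rfl fun s _ => ?_
  rw [Fin.prod_univ_succ]
  simp only [algebraMap_int_eq, eq_intCast, radixPt_zero, radixPt_succ]
  have hprod : ∏ l : Fin n, cexp (ρι (w l) * (x : ℂ) ^ (e l)) ^ (s l.succ) =
      cexp (∑ l : Fin n, (s l.succ : ℂ) * (ρι (w l) * (x : ℂ) ^ (e l))) := by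
    rw [Complex.exp_sum]
    exact Finset.prod_congr rfl fun l _ => by rw [← Complex.exp_nat_mul]
  rw [hprod]
  ring

/-- `FR P w e` is `C¹` along the reals. -/
theorem contDiff_FR (P : MvPolynomial (Fin (n + 1)) ℤ) (w : Fin n → ℚ × ℚ) (e : Fin n → ℕ) :
    ContDiff ℝ 1 (FR P w e) := by
  unfold FR
  have hx : ContDiff ℝ 1 (fun x : ℝ => (x : ℂ)) := Complex.ofRealCLM.contDiff
  refine ContDiff.sum fun s _ => ?_
  exact (contDiff_const.mul (hx.pow _)).mul
    (Complex.contDiff_exp.comp (ContDiff.sum fun l _ => contDiff_const.mul (contDiff_const.mul (hx.pow _))))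

/-- Local Lipschitz bound for `FR P w e` at `T`. -/
theorem exists_lipschitz_FR (P : MvPolynomial (Fin (n + 1)) ℤ) (w : Fin n → ℚ × ℚ) (e : Fin n → ℕ)
    (T : ℝ) : ∃ K δ₁ : ℝ, 0 ≤ K ∧ 0 < δ₁ ∧
      ∀ x : ℝ, |x - T| < δ₁ → ‖FR P w e x - FR P w e T‖ ≤ K * |x - T| := by
  obtain ⟨K, t, ht, hK⟩ := ((contDiff_FR P w e).contDiffAt (x := T)).exists_lipschitzOnWith
  obtain ⟨δ₁, hδ₁, hball⟩ := Metric.mem_nhds_iff.mp ht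
  refine ⟨K, δ₁, K.2, hδ₁, fun x hx => ?_⟩
  have hxt : x ∈ t := hball (by rw [Metric.mem_ball, Real.dist_eq]; exact hx)
  have hTt : T ∈ t := hball (Metric.mem_ball_self hδ₁)
  have := (lipschitzOnWith_iff_dist_le_mul.mp hK) x hxt T hTt
  rwa [dist_eq_norm, Real.dist_eq] at this

/-- **The collapse identity** `Σ_s coef_s · e^{ρ(expo_s)} = den(r)^D · F(r)`. -/
theorem sum_coef_exp (P : MvPolynomial (Fin (n + 1)) ℤ) {D : ℕ} (hD : ∀ s ∈ P.support, s 0 ≤ D)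
    (w : Fin n → ℚ × ℚ) (e : Fin n → ℕ) (r : ℚ) :
    ∑ s ∈ P.support, (coef P D r s : ℂ) * cexp (ρι (expo w e r s)) = (r.den : ℂ) ^ D * FR P w e (r : ℝ) := by
  rw [FR, Finset.mul_sum]
  refine Finset.sum_congr rfl fun s hs => ?_
  rw [coef_cast P (hD s hs), ρι_expo]
  push_cast
  ring

/-! ### The two rational difference polynomials of a pair of exponential parts -/

/-- `Δ₁ = Σ_l (t_l − t'_l) u_l X^{e_l} ∈ ℚ[X]` (first coordinates). -/
def Δ1 (w : Fin n → ℚ × ℚ) (e : Fin n → ℕ) (t t' : Fin n → ℕ) : ℚ[X] :=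
  ∑ l : Fin n, C ((((t l : ℤ) - (t' l : ℤ) : ℤ) : ℚ) * (w l).1) * X ^ (e l)

/-- `Δ₂ = Σ_l (t_l − t'_l) v_l X^{e_l} ∈ ℚ[X]` (second coordinates). -/
def Δ2 (w : Fin n → ℚ × ℚ) (e : Fin n → ℕ) (t t' : Fin n → ℕ) : ℚ[X] :=
  ∑ l : Fin n, C ((((t l : ℤ) - (t' l : ℤ) : ℤ) : ℚ) * (w l).2) * X ^ (e l)

/-- g41's Gaussian difference polynomial decomposes as `Δ₁ + i·Δ₂`. -/
theorem diffPoly_eq (w : Fin n → ℚ × ℚ) (e : Fin n → ℕ) (t t' : Fin n → ℕ) :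
    diffPoly w e t t' = (Δ1 w e t t').map (algebraMap ℚ ℂ) + C I * (Δ2 w e t t').map (algebraMap ℚ ℂ) := by
  simp only [diffPoly, Δ1, Δ2, Polynomial.map_sum, Polynomial.map_mul, Polynomial.map_pow, Polynomial.map_X,
    Polynomial.map_C, Finset.mul_sum, ← Finset.sum_add_distrib]
  refine Finset.sum_congr rfl fun l _ => ?_
  rw [Polynomial.smul_monomial, ← C_mul_X_pow_eq_monomial, gι]
  simp only [map_mul, map_intCast, eq_ratCast, zsmul_eq_mul, map_add]
  ring

/-- FREENESS ⇒ for different exponential parts, `Δ₁ ≠ 0` or `Δ₂ ≠ 0`. -/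
theorem Δ_ne_zero {w : Fin n → ℚ × ℚ} {e : Fin n → ℕ}
    (hLI : LinearIndependent ℤ (fun l : Fin n => Polynomial.monomial (e l) (gι (w l))))
    {t t' : Fin n → ℕ} (h : t ≠ t') : Δ1 w e t t' ≠ 0 ∨ Δ2 w e t t' ≠ 0 := by
  by_contra hc
  push Not at hc
  apply diffPoly_ne_zero hLI h
  simp [diffPoly_eq, hc.1, hc.2]

/-- If `v_l = 0` whenever `e_l = 0`, then `Δ₂` has no constant term. -/
theorem coeff_Δ2_zero {w : Fin n → ℚ × ℚ} {e : Fin n → ℕ} (hv0 : ∀ l, e l = 0 → (w l).2 = 0)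
    (t t' : Fin n → ℕ) : (Δ2 w e t t').coeff 0 = 0 := by
  rw [Δ2, finsetSum_coeff]
  refine Finset.sum_eq_zero fun l _ => ?_
  rw [coeff_C_mul_X_pow]
  by_cases h : e l = 0
  · rw [if_pos h.symm, hv0 l h, mul_zero]
  · rw [if_neg (Ne.symm h)]

/-- First coordinates of collapsed exponents differ by `Δ₁(r)`. -/
theorem expo_fst_sub (w : Fin n → ℚ × ℚ) (e : Fin n → ℕ) (r : ℚ) (s s' : Fin (n + 1) →₀ ℕ) :
    (expo w e r s).1 - (expo w e r s').1 = (Δ1 w e (tail s) (tail s')).eval r := by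
  simp only [expo, Δ1, eval_finsetSum, eval_mul, eval_pow, eval_C, eval_X, ← Finset.sum_sub_distrib, tail]
  refine Finset.sum_congr rfl fun l _ => ?_
  push_cast; ring

/-- Second coordinates of collapsed exponents differ by `Δ₂(r)`. -/
theorem expo_snd_sub (w : Fin n → ℚ × ℚ) (e : Fin n → ℕ) (r : ℚ) (s s' : Fin (n + 1) →₀ ℕ) :
    (expo w e r s).2 - (expo w e r s').2 = (Δ2 w e (tail s) (tail s')).eval r := by
  simp only [expo, Δ2, eval_finsetSum, eval_mul, eval_pow, eval_C, eval_X, ← Finset.sum_sub_distrib, tail]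
  refine Finset.sum_congr rfl fun l _ => ?_
  push_cast; ring

/-! ### Transcendental parameters avoid rational roots and integer values -/

/-- A real Liouville number of exponential order `≥ 3` is transcendental over `ℚ`. -/
theorem transcendental_of_liouvilleOrder {k : ℕ} (hk : 3 ≤ k) {T : ℝ} (hT : LiouvilleOrder k T) :
    Transcendental ℚ T := fun halg =>
  (hT.liouville hk).transcendental ((IsFractionRing.isAlgebraic_iff ℤ ℚ ℝ).mpr halg)

/-- A non-zero rational polynomial does not vanish at a transcendental real. -/
private theorem aeval_ne_zero_of_transcendental {p : ℚ[X]} (hp : p ≠ 0) {T : ℝ} (hT : Transcendental ℚ T) :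
    aeval T p ≠ 0 := fun h => hT ⟨p, hp, h⟩

/-- A non-zero rational polynomial WITHOUT CONSTANT TERM takes a non-integer value at a transcendental real. -/
theorem aeval_not_int_of_transcendental {p : ℚ[X]} (hp : p ≠ 0) (hp0 : p.coeff 0 = 0) {T : ℝ}
    (hT : Transcendental ℚ T) : aeval T p ∉ Set.range (Int.cast : ℤ → ℝ) := by
  rintro ⟨k, hk⟩
  have hq : p - C (k : ℚ) ≠ 0 := by
    intro h0
    have hc := congrArg (fun q : ℚ[X] => q.coeff 0) h0
    simp only [coeff_sub, coeff_C_zero, coeff_zero, hp0, zero_sub, neg_eq_zero, Int.cast_eq_zero] at hc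
    apply hp
    rw [sub_eq_zero] at h0
    rw [h0, hc, Int.cast_zero, map_zero]
  refine aeval_ne_zero_of_transcendental hq hT ?_
  rw [map_sub, aeval_C, ← hk, eq_ratCast, Rat.cast_intCast, sub_self]

/-- Values of a rational polynomial at rationals, read in `ℝ`. -/
theorem aeval_ratCast (p : ℚ[X]) (r : ℚ) : aeval (r : ℝ) p = ((p.eval r : ℚ) : ℝ) := by
  have : (r : ℝ) = algebraMap ℚ ℝ r := rfl
  rw [this, aeval_algebraMap_apply_eq_algebraMap_eval]
  rfl

/-- **RESIDUE AVOIDANCE NEAR `T`.**  Under freeness and `v_l = 0` on constant coordinates, for every pair of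
different exponential parts, EVENTUALLY near the transcendental `T`: `Δ₁(x) ≠ 0` or `Δ₂(x) ∉ ℤ`. -/
theorem eventually_avoid {w : Fin n → ℚ × ℚ} {e : Fin n → ℕ}
    (hLI : LinearIndependent ℤ (fun l : Fin n => Polynomial.monomial (e l) (gι (w l))))
    (hv0 : ∀ l, e l = 0 → (w l).2 = 0) {T : ℝ} (hT : Transcendental ℚ T) {t t' : Fin n → ℕ} (h : t ≠ t') :
    ∀ᶠ x : ℝ in 𝓝 T, aeval x (Δ1 w e t t') ≠ 0 ∨ aeval x (Δ2 w e t t') ∉ Set.range (Int.cast : ℤ → ℝ) := by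
  rcases Δ_ne_zero hLI h with h1 | h2
  · have hc : ContinuousAt (fun x : ℝ => aeval x (Δ1 w e t t')) T :=
      (Polynomial.continuous_aeval _).continuousAt
    have hmem : {y : ℝ | y ≠ 0} ∈ 𝓝 (aeval T (Δ1 w e t t')) :=
      isOpen_ne.mem_nhds (aeval_ne_zero_of_transcendental h1 hT)
    exact (hc.eventually_mem hmem).mono fun x hx => Or.inl hx
  · by_cases h1 : Δ1 w e t t' = 0
    · have hc : ContinuousAt (fun x : ℝ => aeval x (Δ2 w e t t')) T :=
        (Polynomial.continuous_aeval _).continuousAt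
      have hmem : (Set.range (Int.cast : ℤ → ℝ))ᶜ ∈ 𝓝 (aeval T (Δ2 w e t t')) :=
        Int.isClosedEmbedding_coe_real.isClosed_range.isOpen_compl.mem_nhds
          (aeval_not_int_of_transcendental h2 (coeff_Δ2_zero hv0 t t') hT)
      exact (hc.eventually_mem hmem).mono fun x hx => Or.inr hx
    · have hc : ContinuousAt (fun x : ℝ => aeval x (Δ1 w e t t')) T :=
        (Polynomial.continuous_aeval _).continuousAt
      have hmem : {y : ℝ | y ≠ 0} ∈ 𝓝 (aeval T (Δ1 w e t t')) :=
        isOpen_ne.mem_nhds (aeval_ne_zero_of_transcendental h1 hT)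
      exact (hc.eventually_mem hmem).mono fun x hx => Or.inl hx

/-- ROOT AVOIDANCE NEAR `T`: the fibre polynomial of a support element does not vanish eventually near `T`. -/
theorem eventually_fib_ne_zero (P : MvPolynomial (Fin (n + 1)) ℤ) {t : Fin (n + 1) →₀ ℕ} (ht : t ∈ P.support)
    {T : ℝ} (hT : Transcendental ℚ T) : ∀ᶠ x : ℝ in 𝓝 T, aeval x (fib P (tail t)) ≠ 0 := by
  have hne : aeval T (fib P (tail t)) ≠ 0 := by
    intro h0
    apply hT
    exact (IsFractionRing.isAlgebraic_iff ℤ ℚ ℝ).mp ⟨fib P (tail t), fib_ne_zero P ht, h0⟩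
  have hc : ContinuousAt (fun x : ℝ => aeval x (fib P (tail t))) T := (Polynomial.continuous_aeval _).continuousAt
  exact hc.eventually_mem (isOpen_ne.mem_nhds hne)

end Concrete

end Summit.Schanuel.Schanuel.Theorems.RootDecomp1ERadixCell

end
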